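import Mathlib
import Literature.NumberTheory.LFunctions.Zhang2022.TypedSection04C
import HarnessLib

/-!
# Zhang (2022), §4 p. 22, proof of Lemma 4.6: display `Z22:§4.u050` DISCHARGED, (4.11) on the
# whole thin strip, and the inner form of (4.12) with the Rouché hypothesis `Z22:§4.u048`

Topic `Literature/NumberTheory/LFunctions/Zhang2022` (Landau–Siegel adjudication tree;
verdict-neutral). Y. Zhang, *Discrete mean estimates and the Landau–Siegel zero*,
arXiv:2211.02515v1 (2022) [Zhang2022LandauSiegel] — **an unrefereed manuscript under
adjudication** (cell siegel-zhang, D-0069; this is a DISCHARGE file: theorems only, no new claims,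
no new facts, over L1-t7's typed nodes `TypedSection04C` and the banked skeleton). §4 p. 22,
proof of (4.12) inside the proof of Lemma 4.6:

> Noting that both `s` and `1−s` [sc. `1−s̄`] are in `Ω₂` if `s` lies on the segment connecting
> `ρ` and `1/2+iγ+w`, by (4.11) we have
> `ℬ(1/2+iγ+w,ψ)/ℬ(ρ,ψ) = exp{∫_ρ^{1/2+iγ+w} ℬ′/ℬ(s,ψ)ds} = exp{−2w log P + O(α𝓛)}
>   = P^{−2w} + O(α𝓛)`.

Kernel content (all `ForAllLarge`, `ψ ∈ Ψ₁`):

* `calB_strip_of_lemma42`, `eq411_strip` — **(4.11) on the whole thin strip**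
  `|σ − 1/2| < 2α`, `|t − 2πt₀| < 𝓛₁ + 3`: from Lemma 4.2 (`F ≠ 0` on `Ω₁`, so `ℬ = Z̃·F(1−·,ψ̄)/F`
  is analytic and zero-free there and `ℬ′/ℬ = Z̃′/Z̃ − F′/F − F̄′/F̄(1−·)`, the tree's
  `Lemma45.logDeriv_calB`), Lemma 4.3 at `s` and `1 − s̄ ∈ Ω₂`, and (4.6) at `s`:
  `‖ℬ′/ℬ(s) + 2log P‖ ≤ (C₆ + 2C₃)𝓛`. (L1-t7's `eq411_of` is the same estimate on the horizontal
  segments of Lemma 4.5, Case 2; here the whole strip, as the segment of p. 22 needs.) The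
  threshold is `𝓛 ≥ 3` only (`2α ≤ (100𝓛)⁻¹log 𝓛`, `2α < 𝓛⁻¹`; `strip_mem`).
* `step4u050Exp_of_lemma42 : Lemma42 → Step4u050Exp`, `step4u050ExpEst_of : Lemma42 → Lemma43 →
  Eq46 → Step4u050ExpEst`, `step4u050_of : Lemma42 → Lemma43 → Eq46 → Step4u050` — **the three
  equalities of display `Z22:§4.u050` DISCHARGED** (modulo their in-paper inputs), via the tree's
  `Lemma45.eq_mul_exp_integral_logDeriv_segment`, `Lemma45.exists_eq_mul_exp` and
  `|e^η − 1| ≤ 2|η|`, `|P^{−2w}| ≤ e^{4π}`; the segment lies in the strip (`segment_mem_strip`).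
* `eq412_inner_of : Lemma42 → Lemma43 → Eq46 → Eq410 → (4.12) for |w| < 2α, Re w > −α` — the
  manuscript's assembly of (4.12) (tree `Lemma45.ineq412_assembly`) on the part of the disc where
  (4.10), stated on `Ω₃ = {σ > 1/2 − α}`, is available (L1-t7's `step4u049_inner_of_eq410` makes
  the same restriction for `Z22:§4.u049`; campaign row G-L1t7-1 records that the full disc is not
  covered by (4.10) as typed);
* `exists_forall_step4u048_inner : Lemma42 → Lemma43 → Eq46 → Eq410 → ∃ c₀ ≥ 0, ∀ c′ > c₀,
  Step4u048 c′` — **the Rouché hypothesis of Lemma 4.6 needs (4.12) only on the circle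
  `|w| = α(1−c′α𝓛)`, where `Re w > −α`**: so Lemma 4.6 does not depend on G-L1t7-1 (the
  composition with the Rouché step is `Section4Lemma46OfLemma44.lean`).

What is NOT claimed: Lemma 4.2, Lemma 4.3, (4.6), (4.10) (CLAIM nodes / discharged elsewhere:
`Skeleton.lemma42_holds`, `Skeleton.lemma43_of`, `Section4.eq46_holds`, `Skeleton.eq410_of`);
(4.12) on the full disc `|w| < 2α`; anything about (8.24), Theorems 1–2, or Landau–Siegel zeros.

## References

* Y. Zhang, arXiv:2211.02515v1 (2022), §4 pp. 21–22: (4.11), Lemma 4.6 (proof), (4.12).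
  [cite: Zhang2022LandauSiegel, §4 (4.11)–(4.12) pp.21–22]
-/

noncomputable section

open Complex Real ComplexConjugate Metric Set

namespace Literature.NumberTheory.LFunctions.Zhang2022.Section4

open Literature.NumberTheory.LFunctions.Zhang2022.Skeleton

/-! ## Elementary facts about `𝓛`, `P`, `α` (private) -/

/-- `log P = 𝓛⁹`. [cite: Zhang2022LandauSiegel, §2 (2.6) p.5] -/
private theorem log_bigP' (D : ℕ) : Real.log (bigP D) = ell D ^ 9 := by
  rw [bigP, Real.log_exp]

/-- `α = π𝓛⁻⁹`. [cite: Zhang2022LandauSiegel, §2 (2.10) p.6] -/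
private theorem alpha_eq' (D : ℕ) : alpha D = π / ell D ^ 9 := by
  rw [alpha, log_bigP']

/-- `𝓛 ≥ 3` once `D ≥ ⌈e³⌉`. [cite: Zhang2022LandauSiegel, §2 (2.1) p.3] -/
private theorem three_le_ell {D : ℕ} (hD : ⌈Real.exp 3⌉₊ ≤ D) : 3 ≤ ell D := by
  have h : Real.exp 3 ≤ D := le_trans (Nat.le_ceil _) (by exact_mod_cast hD)
  exact (Real.le_log_iff_exp_le (lt_of_lt_of_le (Real.exp_pos _) h)).mpr h

/-- `D ≥ 3` once `D ≥ ⌈e³⌉`. [folklore] -/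
private theorem three_le_of_ceil_le {D : ℕ} (hD : ⌈Real.exp 3⌉₊ ≤ D) : 3 ≤ D := by
  have h9 : Real.exp 3 ≤ D := le_trans (Nat.le_ceil _) (by exact_mod_cast hD)
  have h20 : (3 : ℝ) ≤ Real.exp 3 := by linarith [Real.add_one_le_exp (3 : ℝ)]
  exact_mod_cast h20.trans h9

/-- `P > 1` for `𝓛 > 0`. [cite: Zhang2022LandauSiegel, §2 (2.6) p.5] -/
private theorem one_lt_bigP' {D : ℕ} (hℓ : 0 < ell D) : 1 < bigP D := by
  rw [bigP]
  exact Real.one_lt_exp_iff.mpr (pow_pos hℓ 9)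

/-- `α > 0` for `𝓛 > 0`. [cite: Zhang2022LandauSiegel, §2 (2.10) p.6] -/
private theorem alpha_pos' {D : ℕ} (hℓ : 0 < ell D) : 0 < alpha D := by
  rw [alpha_eq']; exact div_pos Real.pi_pos (pow_pos hℓ 9)

/-- For `𝓛 ≥ 3`: `2α ≤ (100𝓛)⁻¹ log 𝓛` and `2α < 𝓛⁻¹` (`2α = 2π𝓛⁻⁹`, `𝓛⁸ ≥ 6561`).
[cite: Zhang2022LandauSiegel, §4 Lemma 4.1 p.16 & Lemma 4.3 p.17] -/
private theorem two_alpha_le {D : ℕ} (hℓ : 3 ≤ ell D) :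
    2 * alpha D ≤ Real.log (ell D) / (100 * ell D) ∧ 2 * alpha D < (ell D)⁻¹ := by
  have hℓ0 : 0 < ell D := by linarith
  have hlog : 1 ≤ Real.log (ell D) := by
    have h3 : (1 : ℝ) < Real.log 3 := by
      rw [Real.lt_log_iff_exp_lt (by norm_num)]
      exact Real.exp_one_lt_d9.trans (by norm_num)
    exact le_trans h3.le (Real.log_le_log (by norm_num) hℓ)
  have h8 : (6561 : ℝ) ≤ ell D ^ 8 := by
    calc (6561 : ℝ) = 3 ^ 8 := by norm_num
      _ ≤ ell D ^ 8 := pow_le_pow_left₀ (by norm_num) hℓ 8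
  have hπ : Real.pi < 3.15 := Real.pi_lt_d2
  have h9 : ell D ^ 9 = ell D ^ 8 * ell D := by ring
  rw [alpha_eq', h9]
  constructor
  · rw [le_div_iff₀ (by positivity)]
    calc 2 * (π / (ell D ^ 8 * ell D)) * (100 * ell D) = 200 * π / ell D ^ 8 := by
          field_simp
          norm_num
      _ ≤ 1 := by
          rw [div_le_one (by positivity)]
          linarith
      _ ≤ Real.log (ell D) := hlog
  · rw [inv_eq_one_div, lt_div_iff₀ hℓ0]
    calc 2 * (π / (ell D ^ 8 * ell D)) * ell D = 2 * π / ell D ^ 8 := by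
          field_simp
      _ < 1 := by
          rw [div_lt_one (by positivity)]
          linarith

/-- `c′α𝓛 → 0` with `𝓛 ≥ 3` folded into the threshold.
[cite: Zhang2022LandauSiegel, §4 Lemma 4.6 (proof) p.22] -/
private theorem exists_delta_le' (c' ε : ℝ) (hε : 0 < ε) :
    ∃ D₀ : ℕ, ⌈Real.exp 3⌉₊ ≤ D₀ ∧ ∀ D : ℕ, D₀ ≤ D → c' * alpha D * ell D ≤ ε := by
  obtain ⟨D₁, _, h⟩ := exists_delta_le c' ε hε
  exact ⟨max ⌈Real.exp 3⌉₊ D₁, le_max_left _ _, fun D hD => h D (le_trans (le_max_right _ _) hD)⟩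

/-! ## The thin strip `|σ − 1/2| < 2α`, `|t − 2πt₀| < 𝓛₁ + 3` around the discs of Lemma 4.6 -/

/-- Points of the strip have positive ordinate (`2πt₀ = 2π𝓛⁵¹⁹ > 𝓛₁ + 3`), lie in `Ω₁`, in `Ω₂`,
in (4.6)'s region `Region45`, and so do their mirror points `1 − s̄` (for `𝓛 ≥ 3`).
[cite: Zhang2022LandauSiegel, §4 Lemma 4.6 (proof) p.22] -/
theorem strip_mem {D : ℕ} (hℓ : 3 ≤ ell D) {s : ℂ} (hre : |s.re - 1 / 2| < 2 * alpha D)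
    (him : |s.im - 2 * π * t0 D| < ell1 D + 3) :
    0 < s.im ∧ s ∈ Omega1 D ∧ (1 - conj s) ∈ Omega1 D ∧ s ∈ Omega2 D ∧
      (1 - conj s) ∈ Omega2 D ∧ s ∈ Region45 D := by
  obtain ⟨h2α, h2α'⟩ := two_alpha_le hℓ
  have hℓ0 : 0 < ell D := by linarith
  have hℓ1 : 1 ≤ ell D := by linarith
  obtain ⟨hre1, hre2⟩ := abs_lt.mp hre
  obtain ⟨him1, him2⟩ := abs_lt.mp him
  have hsmall : Real.log (ell D) / (100 * ell D) ≤ 1 := by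
    rw [div_le_one (by positivity)]
    linarith [Real.log_le_sub_one_of_pos hℓ0]
  have hinv : (ell D)⁻¹ ≤ 1 := inv_le_one_of_one_le₀ hℓ1
  have h1L : 2 * alpha D < 1 / ell D := by rw [one_div]; exact h2α'
  have h1L' : 1 / ell D ≤ 1 := by rw [one_div]; exact hinv
  -- `t > 0`: `𝓛₁ + 3 = 𝓛⁴⁰⁵ + 3 < 2π𝓛⁵¹⁹ = 2πt₀`
  have ht0 : ell1 D + 3 < 2 * π * t0 D := by
    rw [ell1, t0]
    have h405 : ell D ^ 405 ≤ ell D ^ 519 := pow_le_pow_right₀ hℓ1 (by norm_num)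
    have h1 : 1 ≤ ell D ^ 519 := one_le_pow₀ hℓ1
    nlinarith [Real.pi_gt_three]
  have hmre : (1 - conj s).re = 1 - s.re := by simp
  have hmim : (1 - conj s).im = s.im := by simp
  refine ⟨by linarith, ?_, ?_, ?_, ?_, ?_⟩
  · rw [Omega1, Lemma43.mem_Omega1_iff]
    exact ⟨by linarith, by linarith, by linarith⟩
  · rw [Omega1, Lemma43.mem_Omega1_iff, hmre, hmim]
    exact ⟨by linarith, by linarith, by linarith⟩
  · rw [Omega2, Lemma43.mem_Omega2_iff]
    exact ⟨by linarith, by linarith, by linarith⟩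
  · rw [Omega2, Lemma43.mem_Omega2_iff, hmre, hmim]
    exact ⟨by linarith, by linarith, by linarith⟩
  · have h1 : (s - s0 D).re = s.re - 1 / 2 := by simp [s0, SmoothWeight.s0]
    have h2 : (s - s0 D).im = s.im - 2 * π * t0 D := by simp [s0, SmoothWeight.s0]
    simp only [Region45, Set.mem_setOf_eq, h1, h2]
    exact ⟨lt_of_lt_of_le hre (by linarith), him⟩

/-- **"both `s` and `1 − s̄` are in `Ω₂`"-type regularity of `ℬ` on the strip, from Lemma 4.2**:
for `D` large and `ψ ∈ Ψ₁`, at every `s` with `|σ − 1/2| < 2α`, `|t − 2πt₀| < 𝓛₁ + 3` the three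
factors of `ℬ = Z̃·F(1−·,ψ̄)/F` are differentiable and non-zero (`Z̃` on `Im > 0`; `F(s) ≠ 0`
and `F(1−s,ψ̄) = conj F(1−s̄,ψ) ≠ 0` by Lemma 4.2 on `Ω₁`), so `ℬ` is analytic and non-zero at
`s` and `ℬ′/ℬ(s) = Z̃′/Z̃(s) − F′/F(s) − F̄′/F̄(1−s)`.
[cite: Zhang2022LandauSiegel, (4.11) p.21 & Lemma 4.6 (proof) p.22] -/
theorem calB_strip_of_lemma42 (h42 : Lemma42) :
    ForAllLarge fun D _ χ => ∀ x ∈ PsiOne χ, ∀ s : ℂ, |s.re - 1 / 2| < 2 * alpha D →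
      |s.im - 2 * π * t0 D| < ell1 D + 3 →
        AnalyticAt ℂ (calB χ x) s ∧ calB χ x s ≠ 0 ∧
          AnalyticAt ℂ (tildeZW χ x) s ∧ tildeZW χ x s ≠ 0 ∧ Fpoly χ x s ≠ 0 ∧
          FpolyBar χ x (1 - s) ≠ 0 ∧
          deriv (calB χ x) s / calB χ x s =
            deriv (tildeZW χ x) s / tildeZW χ x s - deriv (Fpoly χ x) s / Fpoly χ x s -
              deriv (FpolyBar χ x) (1 - s) / FpolyBar χ x (1 - s) := by
  obtain ⟨D₁, hF⟩ := fpoly_ne_zero_of_lemma42 h42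
  refine ⟨max D₁ ⌈Real.exp 3⌉₊, fun D _ χ hD hq hp x hx s hre him => ?_⟩
  have hD1 : D₁ ≤ D := le_trans (le_max_left _ _) hD
  have hD3c : ⌈Real.exp 3⌉₊ ≤ D := le_trans (le_max_right _ _) hD
  have hℓ3 := three_le_ell hD3c
  have hD3 := three_le_of_ceil_le hD3c
  obtain ⟨ht0, hΩ1, hΩ1', -, -, -⟩ := strip_mem hℓ3 hre him
  have hpc : (psiChi χ x).IsPrimitive := psiChiPrimitive_holds D χ x hD3 hp
  have hZa : AnalyticAt ℂ (tildeZW χ x) s :=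
    (GammaFactor.analyticAt_Zfac x.ψ ht0).mul (GammaFactor.analyticAt_Zfac (psiChi χ x) ht0)
  have hZ0 : tildeZW χ x s ≠ 0 :=
    mul_ne_zero (GammaFactor.Zfac_ne_zero x.prim ht0) (GammaFactor.Zfac_ne_zero hpc ht0)
  have hF0 : Fpoly χ x s ≠ 0 := hF D χ hD1 hq hp x hx s hΩ1
  have hFb0 : FpolyBar χ x (1 - s) ≠ 0 := by
    rw [FpolyBar_eq_conj hq, map_sub, map_one]
    exact (map_ne_zero _).mpr (hF D χ hD1 hq hp x hx _ hΩ1')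
  have hFa : AnalyticAt ℂ (Fpoly χ x) s := (differentiable_Fpoly χ x).analyticAt s
  have hFba : AnalyticAt ℂ (fun z => FpolyBar χ x (1 - z)) s :=
    ((differentiable_FpolyBar χ x).comp
      ((differentiable_const 1).sub differentiable_id)).analyticAt s
  have hcalB : calB χ x = fun z => tildeZW χ x z * FpolyBar χ x (1 - z) / Fpoly χ x z := by
    funext z; rfl
  have key := Lemma45.logDeriv_calB (Z := tildeZW χ x) (Fb := FpolyBar χ x) (F := Fpoly χ x)
    hZ0 hFb0 hF0 hZa.differentiableAt (differentiable_FpolyBar χ x (1 - s))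
    (differentiable_Fpoly χ x s)
  simp only [logDeriv_apply] at key
  refine ⟨?_, ?_, hZa, hZ0, hF0, hFb0, ?_⟩
  · rw [hcalB]; exact (hZa.mul hFba).div hFa hF0
  · rw [hcalB]; exact div_ne_zero (mul_ne_zero hZ0 hFb0) hF0
  · rw [hcalB]; exact key

/-- **(4.11) on the whole thin strip** ("Hence, by Lemma 4.3 and (4.6)", p.21, as used on p.22
for the segment from `ρ` to `1/2+iγ+w`): for `D` large, `ψ ∈ Ψ₁` and every `s` with
`|σ − 1/2| < 2α`, `|t − 2πt₀| < 𝓛₁ + 3`, `‖ℬ′/ℬ(s) + 2log P‖ ≤ C𝓛` — from Lemma 4.2 (regularity),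
Lemma 4.3 at `s, 1−s̄ ∈ Ω₂` and (4.6) at `s`; constant `C₆ + 2C₃`.
[cite: Zhang2022LandauSiegel, (4.11) p.21 & Lemma 4.6 (proof) p.22] -/
theorem eq411_strip (h42 : Lemma42) (h43 : Lemma43) (h46 : Eq46) :
    ∃ C : ℝ, ForAllLarge fun D _ χ => ∀ x ∈ PsiOne χ, ∀ s : ℂ, |s.re - 1 / 2| < 2 * alpha D →
      |s.im - 2 * π * t0 D| < ell1 D + 3 →
        ‖deriv (calB χ x) s / calB χ x s + 2 * Real.log (bigP D)‖ ≤ C * ell D := by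
  obtain ⟨D₁, hB⟩ := calB_strip_of_lemma42 h42
  obtain ⟨C₃, D₂, h43'⟩ := h43
  obtain ⟨C₆, D₃, h46'⟩ := h46
  refine ⟨C₆ + C₃ + C₃, max (max D₁ D₂) (max D₃ ⌈Real.exp 3⌉₊),
    fun D _ χ hD hq hp x hx s hre him => ?_⟩
  have hD1 : D₁ ≤ D := le_trans (le_trans (le_max_left _ _) (le_max_left _ _)) hD
  have hD2 : D₂ ≤ D := le_trans (le_trans (le_max_right _ _) (le_max_left _ _)) hD
  have hD3 : D₃ ≤ D := le_trans (le_trans (le_max_left _ _) (le_max_right _ _)) hD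
  have hD3c : ⌈Real.exp 3⌉₊ ≤ D := le_trans (le_trans (le_max_right _ _) (le_max_right _ _)) hD
  have hℓ3 := three_le_ell hD3c
  obtain ⟨-, -, -, hΩ2, hΩ2', hR⟩ := strip_mem hℓ3 hre him
  obtain ⟨-, -, -, -, -, -, eId⟩ := hB D χ hD1 hq hp x hx s hre him
  have e43a := h43' D χ hD2 hq hp x hx s hΩ2
  have e43b := h43' D χ hD2 hq hp x hx (1 - conj s) hΩ2'
  have e46 := h46' D χ hD3 hq hp x s hR
  -- `F̄′/F̄(1 − s) = conj (F′/F(1 − s̄))`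
  have hfun : FpolyBar χ x = conj ∘ Fpoly χ x ∘ conj := funext fun z => FpolyBar_eq_conj hq x z
  have hFb : deriv (FpolyBar χ x) (1 - s) / FpolyBar χ x (1 - s)
      = conj (deriv (Fpoly χ x) (1 - conj s) / Fpoly χ x (1 - conj s)) := by
    rw [hfun, deriv_conj_conj]
    simp [map_div₀]
  rw [eId, hFb]
  set X := deriv (tildeZW χ x) s / tildeZW χ x s
  set Y := deriv (Fpoly χ x) s / Fpoly χ x s
  set V := deriv (Fpoly χ x) (1 - conj s) / Fpoly χ x (1 - conj s)
  have hV : ‖conj V‖ = ‖V‖ := Complex.norm_conj V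
  have hsplit : X - Y - conj V + 2 * (Real.log (bigP D) : ℂ) =
      (X + 2 * Real.log (bigP D)) - Y - conj V := by ring
  rw [hsplit]
  calc ‖X + 2 * (Real.log (bigP D) : ℂ) - Y - conj V‖
      ≤ ‖X + 2 * (Real.log (bigP D) : ℂ) - Y‖ + ‖conj V‖ := norm_sub_le _ _
    _ ≤ ‖X + 2 * (Real.log (bigP D) : ℂ)‖ + ‖Y‖ + ‖conj V‖ := by
        gcongr; exact norm_sub_le _ _
    _ ≤ C₆ * ell D + C₃ * ell D + C₃ * ell D := by rw [hV]; gcongr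
    _ = (C₆ + C₃ + C₃) * ell D := by ring

/-! ## The segment from `ρ` to `1/2 + iγ + w` lies in the strip -/

/-- For `ρ = β + iγ` in Lemma 4.6's region, `|w| < 2α` and `u ∈ [0,1]`, the point
`ρ + u((1/2+iγ+w) − ρ)` has `|σ − 1/2| < 2α` and `|t − 2πt₀| < 𝓛₁ + 3` (convexity; `α² < 2α`).
[cite: Zhang2022LandauSiegel, Lemma 4.6 (proof) p.22] -/
theorem segment_mem_strip {D : ℕ} (hℓ : 3 ≤ ell D) {ρ : ℂ} (hρ : ρ ∈ lemma46Region D) {w : ℂ}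
    (hw : ‖w‖ < 2 * alpha D) {u : ℝ} (hu0 : 0 ≤ u) (hu1 : u ≤ 1) :
    |(ρ + u * ((1 / 2 : ℂ) + ρ.im * I + w - ρ)).re - 1 / 2| < 2 * alpha D ∧
      |(ρ + u * ((1 / 2 : ℂ) + ρ.im * I + w - ρ)).im - 2 * π * t0 D| < ell1 D + 3 := by
  have hℓ0 : 0 < ell D := by linarith
  have hα := alpha_pos' hℓ0
  obtain ⟨-, h2α'⟩ := two_alpha_le hℓ
  have hα1 : alpha D < 1 := by
    have := inv_le_one_of_one_le₀ (show (1 : ℝ) ≤ ell D by linarith)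
    linarith
  have hα2 : alpha D ^ 2 < 2 * alpha D := by nlinarith
  obtain ⟨hβ1, hβ2, hγ⟩ := hρ
  have hwre : |w.re| < 2 * alpha D := lt_of_le_of_lt (abs_re_le_norm w) hw
  have hwim : |w.im| < 2 * alpha D := lt_of_le_of_lt (abs_im_le_norm w) hw
  obtain ⟨hwre1, hwre2⟩ := abs_lt.mp hwre
  obtain ⟨hwim1, hwim2⟩ := abs_lt.mp hwim
  obtain ⟨hγ1, hγ2⟩ := abs_lt.mp hγ
  have e1 : (ρ + u * ((1 / 2 : ℂ) + ρ.im * I + w - ρ)).re =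
      (1 - u) * (ρ.re - 1 / 2) + u * w.re + 1 / 2 := by
    simp; ring
  have e2 : (ρ + u * ((1 / 2 : ℂ) + ρ.im * I + w - ρ)).im - 2 * π * t0 D =
      (ρ.im - 2 * π * t0 D) + u * w.im := by
    simp; ring
  have hu1' : 0 ≤ 1 - u := by linarith
  have h2α1 : 2 * alpha D < 1 := lt_of_lt_of_le h2α' (inv_le_one_of_one_le₀ (by linarith))
  constructor
  · rw [e1, add_sub_cancel_right]
    have ha : |ρ.re - 1 / 2| < 2 * alpha D := by
      rw [abs_of_nonneg (by linarith)]; linarith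
    set M := max |ρ.re - 1 / 2| |w.re| with hM
    have hMlt : M < 2 * alpha D := max_lt ha hwre
    calc |(1 - u) * (ρ.re - 1 / 2) + u * w.re|
        ≤ |(1 - u) * (ρ.re - 1 / 2)| + |u * w.re| := abs_add_le _ _
      _ = (1 - u) * |ρ.re - 1 / 2| + u * |w.re| := by
          rw [abs_mul, abs_mul, abs_of_nonneg hu1', abs_of_nonneg hu0]
      _ ≤ (1 - u) * M + u * M := by
          gcongr
          · exact le_max_left _ _
          · exact le_max_right _ _
      _ = M := by ring
      _ < 2 * alpha D := hMlt
  · rw [e2]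
    calc |ρ.im - 2 * π * t0 D + u * w.im| ≤ |ρ.im - 2 * π * t0 D| + |u * w.im| := abs_add_le _ _
      _ = |ρ.im - 2 * π * t0 D| + u * |w.im| := by rw [abs_mul, abs_of_nonneg hu0]
      _ ≤ |ρ.im - 2 * π * t0 D| + 1 * (2 * alpha D) := by gcongr
      _ < ell1 D + 3 := by linarith

/-! ## `Z22:§4.u050` discharged -/

/-- **`Step4u050Exp` HOLDS given Lemma 4.2** ("`ℬ(1/2+iγ+w,ψ)/ℬ(ρ,ψ) = exp{∫_ρ^{1/2+iγ+w}
ℬ′/ℬ(s,ψ)ds}`", p.22): `ℬ` is analytic and zero-free along the segment (Lemma 4.2 via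
`calB_strip_of_lemma42`), so the tree's exact identity
`Lemma45.eq_mul_exp_integral_logDeriv_segment` applies.
[cite: Zhang2022LandauSiegel, Lemma 4.6 (proof) p.22] -/
theorem step4u050Exp_of_lemma42 (h42 : Lemma42) : Step4u050Exp := by
  obtain ⟨D₁, hB⟩ := calB_strip_of_lemma42 h42
  refine ⟨max D₁ ⌈Real.exp 3⌉₊, fun D _ χ hD hq hp x hx ρ hρ _ w hw => ?_⟩
  have hD1 : D₁ ≤ D := le_trans (le_max_left _ _) hD
  have hℓ3 := three_le_ell (le_trans (le_max_right _ _) hD)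
  set w' : ℂ := (1 / 2 : ℂ) + ρ.im * I + w - ρ with hw'
  have hseg : ∀ u ∈ Icc (0 : ℝ) 1,
      AnalyticAt ℂ (calB χ x) (ρ + u * w') ∧ calB χ x (ρ + u * w') ≠ 0 := by
    intro u hu
    obtain ⟨h1, h2⟩ := segment_mem_strip hℓ3 hρ hw hu.1 hu.2
    obtain ⟨ha, hne, -⟩ := hB D χ hD1 hq hp x hx _ h1 h2
    exact ⟨ha, hne⟩
  have key := Lemma45.eq_mul_exp_integral_logDeriv_segment (g := calB χ x) (a := ρ) (w := w')
    (fun u hu => (hseg u hu).1) (fun u hu => (hseg u hu).2)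
  have hρ0 : calB χ x ρ ≠ 0 := by
    have := (hseg 0 ⟨le_rfl, zero_le_one⟩).2
    simpa using this
  have hsum : ρ + w' = 1 / 2 + ρ.im * I + w := by rw [hw']; ring
  rw [hsum] at key
  rw [key, mul_div_cancel_left₀ _ hρ0]

/-- **`Step4u050ExpEst` HOLDS given Lemma 4.2, Lemma 4.3 and (4.6)** ("`= exp{−2w log P +
O(α𝓛)}`", p.22): integrate the strip form of (4.11) along the segment (the tree's
`Lemma45.exists_eq_mul_exp` with `m = −2log P`, `E = C𝓛`); the segment direction is
`w′ = w + (1/2 − β)` with `|w′| ≤ |w| + α² < 3α`, and `2(log P)(β − 1/2) ≤ 2(log P)α² = 2πα`, so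
the total error is `≤ (3C + 2π)α𝓛`. [cite: Zhang2022LandauSiegel, Lemma 4.6 (proof) p.22] -/
theorem step4u050ExpEst_of (h42 : Lemma42) (h43 : Lemma43) (h46 : Eq46) : Step4u050ExpEst := by
  obtain ⟨D₁, hB⟩ := calB_strip_of_lemma42 h42
  obtain ⟨C, D₂, h411⟩ := eq411_strip h42 h43 h46
  refine ⟨3 * |C| + 2 * π, max (max D₁ D₂) ⌈Real.exp 3⌉₊, fun D _ χ hD hq hp x hx ρ hρ _ w hw => ?_⟩
  have hD1 : D₁ ≤ D := le_trans (le_trans (le_max_left _ _) (le_max_left _ _)) hD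
  have hD2 : D₂ ≤ D := le_trans (le_trans (le_max_right _ _) (le_max_left _ _)) hD
  have hℓ3 := three_le_ell (le_trans (le_max_right _ _) hD)
  have hℓ0 : 0 < ell D := by linarith
  have hℓ1 : 1 ≤ ell D := by linarith
  have hα := alpha_pos' hℓ0
  have hα1 : alpha D ≤ 1 := by
    obtain ⟨-, h⟩ := two_alpha_le hℓ3
    have := inv_le_one_of_one_le₀ hℓ1
    linarith
  set w' : ℂ := (1 / 2 : ℂ) + ρ.im * I + w - ρ with hw'
  have hseg : ∀ u ∈ Icc (0 : ℝ) 1,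
      AnalyticAt ℂ (calB χ x) (ρ + u * w') ∧ calB χ x (ρ + u * w') ≠ 0 ∧
        ‖deriv (calB χ x) (ρ + u * w') / calB χ x (ρ + u * w') -
            (-(2 * (Real.log (bigP D) : ℂ)))‖ ≤ |C| * ell D := by
    intro u hu
    obtain ⟨h1, h2⟩ := segment_mem_strip hℓ3 hρ hw hu.1 hu.2
    obtain ⟨ha, hne, -⟩ := hB D χ hD1 hq hp x hx _ h1 h2
    have h3 := h411 D χ hD2 hq hp x hx _ h1 h2
    refine ⟨ha, hne, ?_⟩
    rw [sub_neg_eq_add]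
    exact h3.trans (by gcongr; exact le_abs_self C)
  obtain ⟨η, hη, heq⟩ := Lemma45.exists_eq_mul_exp (g := calB χ x) (a := ρ) (w := w')
    (m := -(2 * (Real.log (bigP D) : ℂ))) (E := |C| * ell D)
    (fun u hu => (hseg u hu).1) (fun u hu => (hseg u hu).2.1) (fun u hu => (hseg u hu).2.2)
  have hρ0 : calB χ x ρ ≠ 0 := by
    have := (hseg 0 ⟨le_rfl, zero_le_one⟩).2.1
    simpa using this
  -- `|w′| ≤ |w| + (β − 1/2) < 2α + α² ≤ 3α`
  obtain ⟨hβ1, hβ2, -⟩ := hρ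
  have hw'eq : w' = w + ((1 / 2 - ρ.re : ℝ) : ℂ) := by
    rw [hw']
    apply Complex.ext
    · simp; ring
    · simp
  have hnw' : ‖w'‖ ≤ 3 * alpha D := by
    rw [hw'eq]
    calc ‖w + ((1 / 2 - ρ.re : ℝ) : ℂ)‖ ≤ ‖w‖ + ‖((1 / 2 - ρ.re : ℝ) : ℂ)‖ := norm_add_le _ _
      _ ≤ 2 * alpha D + alpha D ^ 2 := by
          rw [Complex.norm_real, Real.norm_eq_abs, abs_of_nonpos (by linarith)]
          linarith
      _ ≤ 3 * alpha D := by nlinarith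
  -- the shift of the main term: `m·w′ = −2w log P + 2 log P (β − 1/2)`
  have hlogP : Real.log (bigP D) * alpha D ^ 2 = π * alpha D := by
    rw [alpha, sq]
    have : Real.log (bigP D) ≠ 0 := by rw [log_bigP']; positivity
    field_simp
  refine ⟨η + 2 * (Real.log (bigP D) : ℂ) * ((ρ.re - 1 / 2 : ℝ) : ℂ), ?_, ?_⟩
  · calc ‖η + 2 * (Real.log (bigP D) : ℂ) * ((ρ.re - 1 / 2 : ℝ) : ℂ)‖
        ≤ ‖η‖ + ‖2 * (Real.log (bigP D) : ℂ) * ((ρ.re - 1 / 2 : ℝ) : ℂ)‖ := norm_add_le _ _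
      _ ≤ |C| * ell D * (3 * alpha D) + 2 * Real.log (bigP D) * alpha D ^ 2 := by
          gcongr
          · exact hη.trans (by gcongr)
          · rw [norm_mul, norm_mul, Complex.norm_real, Complex.norm_real, Real.norm_eq_abs,
              Real.norm_eq_abs, abs_of_nonneg (by rw [log_bigP']; positivity),
              abs_of_nonneg (by linarith)]
            simp only [Complex.norm_ofNat]
            have : 0 ≤ Real.log (bigP D) := by rw [log_bigP']; positivity
            nlinarith
      _ = (3 * |C| + 2 * π) * (alpha D * ell D) - 2 * π * alpha D * (ell D - 1) := by
          rw [mul_assoc 2, hlogP]; ring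
      _ ≤ (3 * |C| + 2 * π) * (alpha D * ell D) := by
          have : 0 ≤ 2 * π * alpha D * (ell D - 1) := by
            have := Real.pi_pos; positivity
          linarith
  · have hsum : ρ + w' = 1 / 2 + ρ.im * I + w := by rw [hw']; ring
    rw [hsum] at heq
    rw [heq, mul_assoc, mul_div_cancel_left₀ _ hρ0, ← Complex.exp_add]
    congr 1
    rw [hw'eq]
    push_cast
    ring

/-- **`Z22:§4.u050` (`Step4u050`) HOLDS given Lemma 4.2, Lemma 4.3 and (4.6)** ("`= P^{−2w} +
O(α𝓛)`", p.22): from `Step4u050ExpEst`, `e^{−2w log P + η} − P^{−2w} = P^{−2w}(e^η − 1)` with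
`|P^{−2w}| ≤ e^{4π}` (`|w| < 2α`) and `|e^η − 1| ≤ 2|η|` once `|η| ≤ 1` (`D` large).
[cite: Zhang2022LandauSiegel, Lemma 4.6 (proof) p.22] -/
theorem step4u050_of (h42 : Lemma42) (h43 : Lemma43) (h46 : Eq46) : Step4u050 := by
  obtain ⟨C, D₁, hE⟩ := step4u050ExpEst_of h42 h43 h46
  obtain ⟨Dδ, hDδ, hδ⟩ := exists_delta_le' (max C 0) 1 one_pos
  refine ⟨2 * Real.exp (4 * π) * max C 0, max D₁ Dδ, fun D _ χ hD hq hp x hx ρ hρ hρ0 w hw => ?_⟩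
  have hD1 : D₁ ≤ D := le_trans (le_max_left _ _) hD
  have hDδ' : Dδ ≤ D := le_trans (le_max_right _ _) hD
  have hℓ3 := three_le_ell (le_trans hDδ hDδ')
  have hℓ0 : 0 < ell D := by linarith
  have hα := alpha_pos' hℓ0
  have hD2 : 2 ≤ D := le_trans (by norm_num) (three_le_of_ceil_le (le_trans hDδ hDδ'))
  obtain ⟨η, hη, heq⟩ := hE D χ hD1 hq hp x hx ρ hρ hρ0 w hw
  have hαℓ : 0 ≤ alpha D * ell D := (mul_pos hα hℓ0).le
  have hη' : ‖η‖ ≤ max C 0 * (alpha D * ell D) := hη.trans (by gcongr; exact le_max_left _ _)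
  have hη1 : ‖η‖ ≤ 1 := hη'.trans (by
    have := hδ D hDδ'
    calc max C 0 * (alpha D * ell D) = max C 0 * alpha D * ell D := by ring
      _ ≤ 1 := this)
  have hP : Pm2w D w = Complex.exp (-(2 * w * Real.log (bigP D))) := by
    rw [Pm2w_eq_Pw, Lemma46.Pw_def]
  rw [heq, Complex.exp_add, hP]
  have hfac : Complex.exp (-(2 * w * Real.log (bigP D))) * Complex.exp η -
      Complex.exp (-(2 * w * Real.log (bigP D))) =
      Complex.exp (-(2 * w * Real.log (bigP D))) * (Complex.exp η - 1) := by ring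
  rw [hfac, norm_mul]
  have h1 : ‖Complex.exp η - 1‖ ≤ 2 * ‖η‖ := Complex.norm_exp_sub_one_le hη1
  have h2 : ‖Complex.exp (-(2 * w * Real.log (bigP D)))‖ ≤ Real.exp (4 * π) := by
    have := norm_Pm2w_le hD2 hw
    rwa [hP] at this
  calc ‖Complex.exp (-(2 * w * Real.log (bigP D)))‖ * ‖Complex.exp η - 1‖
      ≤ Real.exp (4 * π) * (2 * (max C 0 * (alpha D * ell D))) := by
        gcongr
        exact h1.trans (by linarith)
    _ = 2 * Real.exp (4 * π) * max C 0 * (alpha D * ell D) := by ring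

/-! ## The inner form of (4.12), and the Rouché hypothesis `Z22:§4.u048` from it

(4.10) is stated on `Ω₃ = {1/2 − α < σ < 1 + α, |t − 2πt₀| < 𝓛₁ + 3}` (`Skeleton.Eq410`), which
does not contain the whole disc `|w| < 2α` of (4.12) (campaign row G-L1t7-1) but does contain its
part `Re w > −α` — and Lemma 4.6's circle `|w| = α(1−c′α𝓛)` lies there. -/

/-- `ρ ∈` Lemma 4.6's region and `1/2 + iγ + w` with `|w| < 2α`, `Re w > −α` both lie in `Ω₃`
(for `𝓛 ≥ 3`). [cite: Zhang2022LandauSiegel, Lemma 4.4 p.19 & Lemma 4.6 (proof) p.22] -/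
theorem mem_Omega3_pair {D : ℕ} (hℓ : 3 ≤ ell D) {ρ : ℂ} (hρ : ρ ∈ lemma46Region D) {w : ℂ}
    (hw : ‖w‖ < 2 * alpha D) (hwre : -alpha D < w.re) :
    ρ ∈ Omega3 D ∧ ((1 / 2 : ℂ) + ρ.im * I + w) ∈ Omega3 D := by
  have hℓ0 : 0 < ell D := by linarith
  have hα := alpha_pos' hℓ0
  obtain ⟨-, h2α'⟩ := two_alpha_le hℓ
  have h2α1 : 2 * alpha D < 1 := lt_of_lt_of_le h2α' (inv_le_one_of_one_le₀ (by linarith))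
  have hα2 : alpha D ^ 2 < alpha D := by nlinarith
  obtain ⟨hβ1, hβ2, hγ⟩ := hρ
  have hwre2 : w.re < 2 * alpha D := lt_of_le_of_lt (le_trans (le_abs_self _) (abs_re_le_norm w)) hw
  have hwim : |w.im| < 2 * alpha D := lt_of_le_of_lt (abs_im_le_norm w) hw
  obtain ⟨hwim1, hwim2⟩ := abs_lt.mp hwim
  obtain ⟨hγ1, hγ2⟩ := abs_lt.mp hγ
  have e1 : ((1 / 2 : ℂ) + ρ.im * I + w).re = 1 / 2 + w.re := by simp
  have e2 : ((1 / 2 : ℂ) + ρ.im * I + w).im = ρ.im + w.im := by simp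
  refine ⟨⟨by linarith, by linarith, ?_⟩, ?_⟩
  · rw [abs_lt]; constructor <;> linarith
  · refine ⟨?_, ?_, ?_⟩
    · rw [e1]; linarith
    · rw [e1]; linarith
    · rw [e2, abs_lt]; constructor <;> linarith

/-- `𝓛⁻¹⁰⁰ ≤ α𝓛 = π𝓛⁻⁸` for `𝓛 ≥ 1`. [cite: Zhang2022LandauSiegel, Lemma 4.6 (proof) p.23] -/
private theorem inv_ell100_le {D : ℕ} (hℓ1 : 1 ≤ ell D) : (ell D ^ 100)⁻¹ ≤ alpha D * ell D := by
  have hℓ0 : 0 < ell D := by linarith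
  have h9 : ell D ^ 9 = ell D ^ 8 * ell D := by ring
  have h2 : alpha D * ell D = π / ell D ^ 8 := by
    rw [alpha_eq', h9, div_mul_eq_mul_div, mul_div_mul_right _ _ hℓ0.ne']
  rw [h2]
  calc (ell D ^ 100)⁻¹ ≤ (ell D ^ 8)⁻¹ :=
        inv_anti₀ (by positivity) (pow_le_pow_right₀ hℓ1 (by norm_num))
    _ = 1 / ell D ^ 8 := inv_eq_one_div _
    _ ≤ π / ell D ^ 8 := by
        gcongr
        linarith [Real.pi_gt_three]

/-- **(4.12) on the part `Re w > −α` of the disc `|w| < 2α`** — "`𝒜(1/2+iγ+w,ψ) − (1−P^{−2w}) ≪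
α𝓛`, the implied constant being independent of `c′`" — from Lemma 4.2, Lemma 4.3, (4.6) and
(4.10) ALONE (no use of (4.10) outside `Ω₃`): the manuscript's assembly "By (4.10) … by (4.11) …
Since `ℬ(ρ,ψ) = −1 + O(𝓛⁻¹⁰⁰)`" (tree `Lemma45.ineq412_assembly`) with the ratio step supplied by
`Z22:§4.u050` (`step4u050_of`). [cite: Zhang2022LandauSiegel, (4.12) p.22] -/
theorem eq412_inner_of (h42 : Lemma42) (h43 : Lemma43) (h46 : Eq46) (h410 : Eq410) :
    ∃ C : ℝ, ForAllLarge fun D _ χ => ∀ x ∈ PsiOne χ, ∀ ρ ∈ lemma46Region D, calA χ x ρ = 0 →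
      ∀ w : ℂ, ‖w‖ < 2 * alpha D → -alpha D < w.re →
        ‖calA χ x (1 / 2 + ρ.im * I + w) - (1 - Pm2w D w)‖ ≤ C * (alpha D * ell D) := by
  obtain ⟨C₅, D₅, h50⟩ := step4u050_of h42 h43 h46
  obtain ⟨D₁, hB⟩ := calB_strip_of_lemma42 h42
  obtain ⟨C₄, D₄, h410'⟩ := h410
  refine ⟨|C₄| * (1 + Real.exp (4 * π)) + (1 + |C₄|) * |C₅|,
    max (max D₁ D₄) (max D₅ ⌈Real.exp 3⌉₊), fun D _ χ hD hq hp x hx ρ hρ hρ0 w hw hwre => ?_⟩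
  have hD1 : D₁ ≤ D := le_trans (le_trans (le_max_left _ _) (le_max_left _ _)) hD
  have hD4 : D₄ ≤ D := le_trans (le_trans (le_max_right _ _) (le_max_left _ _)) hD
  have hD5 : D₅ ≤ D := le_trans (le_trans (le_max_left _ _) (le_max_right _ _)) hD
  have hD3c : ⌈Real.exp 3⌉₊ ≤ D := le_trans (le_trans (le_max_right _ _) (le_max_right _ _)) hD
  have hℓ3 := three_le_ell hD3c
  have hℓ0 : 0 < ell D := by linarith
  have hℓ1 : 1 ≤ ell D := by linarith
  have hD2 : 2 ≤ D := le_trans (by norm_num) (three_le_of_ceil_le hD3c)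
  have hα := alpha_pos' hℓ0
  have hαℓ : 0 < alpha D * ell D := mul_pos hα hℓ0
  obtain ⟨hρΩ3, hwΩ3⟩ := mem_Omega3_pair hℓ3 hρ hw hwre
  -- (4.10) at `ρ` and at `1/2 + iγ + w`
  have e410ρ := h410' D χ hD4 hq hp x hx ρ hρΩ3
  have e410w := h410' D χ hD4 hq hp x hx _ hwΩ3
  -- the ratio step (u050) and `ℬ(ρ) ≠ 0`
  have e50 := h50 D χ hD5 hq hp x hx ρ hρ hρ0 w hw
  have hρstrip := segment_mem_strip hℓ3 hρ hw le_rfl zero_le_one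
  simp only [Complex.ofReal_zero, zero_mul, add_zero] at hρstrip
  obtain ⟨-, hBρ0, -⟩ := hB D χ hD1 hq hp x hx ρ hρstrip.1 hρstrip.2
  -- sizes
  set E : ℝ := C₄ * (ell D ^ 100)⁻¹ with hE
  have hE0 : 0 ≤ E := le_trans (norm_nonneg _) e410ρ
  have hEle : E ≤ |C₄| * (alpha D * ell D) := by
    rw [hE]
    calc C₄ * (ell D ^ 100)⁻¹ ≤ |C₄| * (ell D ^ 100)⁻¹ := by
          gcongr; exact le_abs_self _
      _ ≤ |C₄| * (alpha D * ell D) := by gcongr; exact inv_ell100_le hℓ1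
  have hEle1 : E ≤ |C₄| := by
    rw [hE]
    calc C₄ * (ell D ^ 100)⁻¹ ≤ |C₄| * (ell D ^ 100)⁻¹ := by
          gcongr; exact le_abs_self _
      _ ≤ |C₄| * 1 := by
          gcongr; exact inv_le_one_of_one_le₀ (one_le_pow₀ hℓ1)
      _ = |C₄| := mul_one _
  have hBρ : ‖calB χ x ρ‖ ≤ 1 + E := by
    have h1 := Lemma45.norm_calB_add_one_le hρ0 e410ρ
    have := norm_add_le (calB χ x ρ + 1) (-1 : ℂ)
    rw [add_neg_cancel_right, norm_neg, norm_one] at this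
    linarith
  have hratio : ‖calB χ x (1 / 2 + ρ.im * I + w) - calB χ x ρ * Pm2w D w‖
      ≤ (1 + |C₄|) * |C₅| * (alpha D * ell D) := by
    have hfac : calB χ x (1 / 2 + ρ.im * I + w) - calB χ x ρ * Pm2w D w
        = calB χ x ρ * (calB χ x (1 / 2 + ρ.im * I + w) / calB χ x ρ - Pm2w D w) := by
      field_simp
    rw [hfac, norm_mul]
    have e50' : ‖calB χ x (1 / 2 + ρ.im * I + w) / calB χ x ρ - Pm2w D w‖
        ≤ |C₅| * (alpha D * ell D) := e50.trans (by gcongr; exact le_abs_self _)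
    calc ‖calB χ x ρ‖ * ‖calB χ x (1 / 2 + ρ.im * I + w) / calB χ x ρ - Pm2w D w‖
        ≤ (1 + E) * (|C₅| * (alpha D * ell D)) :=
          mul_le_mul hBρ e50' (norm_nonneg _) (by linarith)
      _ ≤ (1 + |C₄|) * (|C₅| * (alpha D * ell D)) := by
          apply mul_le_mul (by linarith) le_rfl (by positivity) (by positivity)
      _ = (1 + |C₄|) * |C₅| * (alpha D * ell D) := by ring
  have hp : ‖Pm2w D w‖ ≤ Real.exp (4 * π) := norm_Pm2w_le hD2 hw
  have key := Lemma45.ineq412_assembly (p := Pm2w D w) hρ0 e410ρ e410w hratio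
  calc ‖calA χ x (1 / 2 + ρ.im * I + w) - (1 - Pm2w D w)‖
      ≤ E + (1 + |C₄|) * |C₅| * (alpha D * ell D) + E * ‖Pm2w D w‖ := key
    _ ≤ |C₄| * (alpha D * ell D) + (1 + |C₄|) * |C₅| * (alpha D * ell D)
        + |C₄| * (alpha D * ell D) * Real.exp (4 * π) := by
        gcongr
    _ = (|C₄| * (1 + Real.exp (4 * π)) + (1 + |C₄|) * |C₅|) * (alpha D * ell D) := by ring

/-- **`Z22:§4.u048` (the Rouché hypothesis of Lemma 4.6) for every sufficiently large `c′`, from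
Lemma 4.2, Lemma 4.3, (4.6) and (4.10) on `Ω₃` only**: on the circle `|w| = α(1−c′α𝓛)` one has
`Re w ≥ −|w| > −α`, so the inner form of (4.12) applies, and (4.13) (`|1−P^{−2w}| > 6c′α𝓛`, the
tree's `Lemma46.ineq413`) gives `|𝒜 − (1−P^{−2w})| < |1−P^{−2w}|` for `c′ > max(C/6, 0)`.
[cite: Zhang2022LandauSiegel, Lemma 4.6 (proof) p.22] -/
theorem exists_forall_step4u048_inner (h42 : Lemma42) (h43 : Lemma43) (h46 : Eq46)
    (h410 : Eq410) : ∃ c₀ : ℝ, 0 ≤ c₀ ∧ ∀ c' : ℝ, c₀ < c' → Step4u048 c' := by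
  obtain ⟨C, D₁, h⟩ := eq412_inner_of h42 h43 h46 h410
  refine ⟨max (C / 6) 0, le_max_right _ _, fun c' hc' => ?_⟩
  have hc : 0 < c' := lt_of_le_of_lt (le_max_right _ _) hc'
  have hC6 : C < 6 * c' := by
    have := lt_of_le_of_lt (le_max_left _ _) hc'
    linarith
  obtain ⟨Dδ, hDδ, hδ⟩ := exists_delta_le' c' (1 / 200) (by norm_num)
  refine ⟨max D₁ Dδ, fun D _ χ hD hq hp x hx ρ hρ hρ0 w hw => ?_⟩
  have hD₁ : D₁ ≤ D := le_trans (le_max_left _ _) hD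
  have hDδ' : Dδ ≤ D := le_trans (le_max_right _ _) hD
  have hℓ : 0 < ell D := by linarith [three_le_ell (le_trans hDδ hDδ')]
  have hα := alpha_pos' hℓ
  set δ : ℝ := c' * alpha D * ell D with hδdef
  have hδ0 : 0 < δ := mul_pos (mul_pos hc hα) hℓ
  have hδ1 : δ ≤ 1 / 200 := hδ D hDδ'
  have hw2 : ‖w‖ < 2 * alpha D := by
    rw [hw]; nlinarith
  have hwre : -alpha D < w.re := by
    have h1 : -‖w‖ ≤ w.re := (abs_le.mp (abs_re_le_norm w)).1
    have h2 : ‖w‖ < alpha D := by rw [hw]; nlinarith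
    linarith
  have h1 := h D χ hD₁ hq hp x hx ρ hρ hρ0 w hw2 hwre
  have h2 : 6 * δ < ‖1 - Pm2w D w‖ := by
    rw [Pm2w_eq_Pw]
    exact Lemma46.ineq413 (one_lt_bigP' hℓ) hδ0 hδ1 (by rw [treeAlpha_eq]; exact hw)
  have hαℓ : 0 < alpha D * ell D := mul_pos hα hℓ
  calc ‖calA χ x (1 / 2 + ρ.im * I + w) - (1 - Pm2w D w)‖ ≤ C * (alpha D * ell D) := h1
    _ ≤ 6 * c' * (alpha D * ell D) := by gcongr
    _ = 6 * δ := by rw [hδdef]; ring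
    _ < ‖1 - Pm2w D w‖ := h2


end Literature.NumberTheory.LFunctions.Zhang2022.Section4

end
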